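import Summits.BirchSwinnertonDyer.BirchSwinnertonDyer.Theorems.GenusKolyvaginAtTwoPowDvdShaCardAtTwoRTExactSwapHybridFrob
import Summits.BirchSwinnertonDyer.BirchSwinnertonDyer.Theorems.KolyvaginRankRigidityAtTwoOppositeSignReciprocityKTerm
import Summits.BirchSwinnertonDyer.BirchSwinnertonDyer.Theorems.Rank1ResidualJetCompatibleData
import HarnessLib

/-!
# Route `GenusKolyvaginAtTwo`, LINE 18 (L_T `PowDvdShaCardAtTwoRT`, stmt-BirchSwinnertonDyer-23659), stub P's reduction —
# KOLYVAGIN'S FIRST SELMER ANNIHILATION AT `2` («layer 1»): on L_T's frame the `(+w)`-eigenpart of `Sel_{2^M}(E/K)` is killed by `2^(M₀+1)`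

Seat `bsd-line-gk2-p5` g28 (cell `bsd-f1-sign2`), `--supports stmt-BirchSwinnertonDyer-23659` (helper; closes nothing).  THEOREMS ONLY
(no definition, no named fact, no `sorry`).  BSD is NOT proved by any of this; neither is L_T, U_T, nor stub P.

WHY.  After LEAD ruling R5 (road (E4)) and (β″), L_T BY NAME is conditional on exactly ONE arithmetic input of the bundle
`PubInputsAtTwo`: Kolyvagin's «`rank E(K) ≤ 1`» (gk2-p4 g21, STATUS 19:35Z; the E4 capstone uses `PubInputsAtTwo.kolyvagin` once, as
`rank ≤ 1`).  On L_T's frame only the `2`-adic tower is surjective, so the rank bound must come from Kolyvagin's descent AT `2`: two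
exponent bounds on `Sel_{2^M}(E/K)` (layer 1: the eigenpart opposite to `y_K`; layer 2: the eigenpart of `y_K` modulo `δ y_K`), then
`E(K)/2^M ↪ Sel` and Mordell–Weil.  THIS FILE is LAYER 1 as a Selmer-level theorem — Kolyvagin's first step [Gross 1991 §§8–10,
McCallum 1991 §5 Thm. 5.4 first rung] at `p = 2` on `Δ < 0`, SHARP (one bit better than the eigen count, via the regular frame):

* §1 `selmerLayerOne_core` (frame currency of the LEAD's `exactSwap_core_frob`: Weil data, Poitou–Tate families, hybrid transverse
  structures, P8/P4/P7a⁼/Q2/T2 displayed): for a conductor-`1` datum `d₁` with `addOrderOf c_M(1) = 2^g` (`g ≥ 1`), (NPh) at level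
  `2^(M+k)` and a Selmer class `z` with `τ_* z = w • z` (`w = W.rootNumber`, the sign of `c_M(ℓ)`, OPPOSITE to that of `c_M(1)`):
  **`2^(M+1−g) • z = 0`**.  Proof = ONE-TERM reciprocity (KRR `sum_localTatePairing_eq_zero_of_dvd` with `m = 1`, `c = ℓ`: `z` Kummer
  everywhere, `c_M(ℓ)` Kummer off `ℓ` (T2, `t = 0`) and transverse at `λ ∣ ℓ` (P4)) `⟨z, c_M(ℓ)⟩_λ = 0` at a deep Kolyvagin prime
  `ℓ` chosen by gk2-p4's EXACT deep pair Čebotarev (p710403) for `(c_M(1), z)` — `loc_λ c_M(1)` of full order `2^g`, `loc_λ z` of full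
  order `2^u` — against the exact same-sign law P7a⁼ (gk2-p3 g23, `2^(a+b−M) • ⟨·,·⟩ ≠ 0` for `M ≤ a+b`; `a = u−1`, `b = g−1`, the
  Kummer threshold of `c_M(ℓ)` read through Q2 at the own prime `ℓ`): contradiction once `u + g ≥ M + 2`.
* §2 `selmerLayerOne_core_hybrid` — P8, P4, P7a⁼, T2 DISCHARGED on the hybrid transverse frame exactly as in the LEAD's
  `exactSwap_core_hybrid_frob` (p729339 lineage); displayed: Q2 by name, (NPh_{M+k}).
* Sequel `…RTSelmerLayerOneAtTwo`: the frame built inside, `z ∈ selmerGroup (W⁄K) (2^M)`, the `M₀`-currency (`2^(M₀) ∥ y_K` ⟹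
  **`2^(M₀+1) • (s + w • τ_* s) = 0` for EVERY `s ∈ Sel_{2^M}(E/K)`**, `M ≥ M₀+1`) and (NPh) discharged on the (D-NPh) habitat — the
  layer-1 input of gk2-p4 g21's rank conclusion, modulo Q2 (an antecedent of L_T) ONLY.

References: [GrossLMS1991] §8 Prop. 8.2, §10; [McCallumLMS1991] §4 Prop. 4.4, Lemma 4.3, §5 Lemma 5.3, Thm. 5.4; [Kolyvagin1991MathAnn] §2 Thm. 2.2.
-/

set_option autoImplicit false
set_option linter.dupNamespace false

noncomputable section

open scoped Classical Pointwise
open Function NumberField IsDedekindDomain WeierstrassCurve Field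
open Literature.NumberTheory.EllipticCurves Literature.NumberTheory.GaloisRepresentations
open Literature.NumberTheory.EllipticCurves.Jetchev2008 Literature.NumberTheory.EllipticCurves.ModularForms
open Literature.NumberTheory.GaloisCohomology
open Literature.NumberTheory.GaloisRepresentations.DiscreteGaloisModule (localTatePairingZMod
  tateDual transverseSubgroup SelmerStructure)
open Literature.NumberTheory.Automorphic
open Summit.BirchSwinnertonDyer.Rank1Residual
open Summit.BirchSwinnertonDyer.Rank1Residual.JET.SelmerVocabulary
open Summit.BirchSwinnertonDyer.Rank1Residual.JET.GlobalDuality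
open Summit.BirchSwinnertonDyer.BirchSwinnertonDyer.Theses.GenusKolyvaginAtTwo (KolyvaginRelationAtTwo)
open Summit.BirchSwinnertonDyer.BirchSwinnertonDyer.Theorems.KolyvaginLowerBoundAtTwo

namespace Summit.BirchSwinnertonDyer.BirchSwinnertonDyer.Theorems.GenusExact.PlusDescent

/-! ## §1 The core, in the frame currency of `exactSwap_core_frob` -/

section Frame

variable {K : Type} [Field K] [NumberField K] (W : WeierstrassCurve ℚ) [W.IsElliptic]
  [W.IsGloballyMinimal] [(W.baseChange K).IsElliptic] [NeZero (W.conductorNorm ℤ)]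
  [∀ M : ℕ, NeZero (2 ^ M)] [∀ M : ℕ, Finite (geomTorsion (W.baseChange K) ((2 ^ M : ℕ) : ℤ))]
  (τ : K ≃ₐ[ℚ] K)
  (Dt : ModularParametrizationData W (W.conductorNorm ℤ)) (β : ℤ) (ι : K →+* ℂ)
  (e : ∀ M : ℕ, geomTorsion (W.baseChange K) ((2 ^ M : ℕ) : ℤ) →
    geomTorsion (W.baseChange K) ((2 ^ M : ℕ) : ℤ) → AlgebraicClosure K)
  (hμ : ∀ M S T, e M S T ^ (2 ^ M) = 1)
  (hadd₁ : ∀ M S₁ S₂ T, e M (S₁ + S₂) T = e M S₁ T * e M S₂ T)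
  (hadd₂ : ∀ M S T₁ T₂, e M S (T₁ + T₂) = e M S T₁ * e M S T₂)
  (hgal : ∀ M (g : absoluteGaloisGroup K) (S T : geomTorsion (W.baseChange K) ((2 ^ M : ℕ) : ℤ)),
    g • e M S T = e M (g • S) (g • T))
  (halt : ∀ M T, e M T T = 1) (hnondeg : ∀ M T, (∀ S, e M S T = 1) → T = 0)
  (inv : ∀ M : ℕ, LocalInvariants K (2 ^ M))
  (𝒯 : ∀ M : ℕ, SelmerStructure ((W.baseChange K).torsionGaloisModule ((2 ^ M : ℕ) : ℤ)))
  (hCM : ¬ W.HasCM) (hΔ : W.Δ < 0)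
  (hsur : ∀ m : ℕ, W.HasSurjectiveModNGaloisRep (2 ^ m : ℕ)) (hK : IsImaginaryQuadratic K)
  (hodd : Odd (NumberField.discr K)) (hne3 : NumberField.discr K ≠ -3)
  (hns : ¬ IsSquare ((NumberField.discr K : ℚ) * -|W.Δ|))
  (hHN : SatisfiesHeegnerHypothesis (W.conductorNorm ℤ) K)
  (hτ1 : τ ≠ 1)
  (hperf : ∀ M, (inv M).IsPerfect) (hvan : ∀ M, (inv M).SumLocalTermEqZero)
  (h𝒯sd : ∀ (M c : ℕ), ∀ v ∈ placesDividing K c,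
    (inv M).dualTransported (𝒯 M) (weilDualIntertwining (W.baseChange K) (2 ^ M) (e M) (hμ M) (hadd₁ M)
      (hadd₂ M) (hgal M)) (Sum.inr v) = 𝒯 M (Sum.inr v))
  (hP4 : ∀ (M c : ℕ) (dat : KolyvaginHeegnerData Dt β ι c),
    KolyvaginDescent.KolSupp (Zhang2014.IsKolyvaginPrime (W.conductorNorm ℤ) W K 2) c → 1 ≤ M →
    (∀ q ∈ c.primeFactors, M + 1 ≤ Zhang2014.kolyvaginIndex W 2 q) →
    ∀ w ∈ placesDividing K c,
      galoisCohomology.localization ((W.baseChange K).torsionGaloisModule ((2 ^ M : ℕ) : ℤ)) (Sum.inr w) 1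
        (dat.kolyvaginClass Nat.prime_two M) ∈ 𝒯 M (Sum.inr w))
  (hP7a : ∀ (M M' ℓ : ℕ) (v : HeightOneSpectrum (𝓞 K))
    (w C : galoisCohomology ((W.baseChange K).torsionGaloisModule ((2 ^ M : ℕ) : ℤ)) 1) (s : ℤ) (a b : ℕ),
    (s = 1 ∨ s = -1) → Zhang2014.IsKolyvaginPrime (W.conductorNorm ℤ) W K 2 ℓ →
    M ≤ Zhang2014.kolyvaginIndex W 2 ℓ → M ≤ M' → FrobEqFrobInfty W K (2 ^ M') ℓ →
    ((ℓ : ℕ) : 𝓞 K) ∈ v.asIdeal →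
    conjAct W τ ((2 ^ M : ℕ) : ℤ) w = s • w → conjAct W τ ((2 ^ M : ℕ) : ℤ) C = s • C →
    galoisCohomology.localization ((W.baseChange K).torsionGaloisModule ((2 ^ M : ℕ) : ℤ)) (Sum.inr v) 1 w ∈
      (W.baseChange K).kummerSelmerStructure ((2 ^ M : ℕ) : ℤ) (Sum.inr v) →
    ((2 ^ a : ℕ) : ℤ) • galoisCohomology.localization ((W.baseChange K).torsionGaloisModule ((2 ^ M : ℕ) : ℤ))
      (Sum.inr v) 1 w ≠ 0 →
    ((2 ^ b : ℕ) : ℤ) • galoisCohomology.localization ((W.baseChange K).torsionGaloisModule ((2 ^ M : ℕ) : ℤ))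
      (Sum.inr v) 1 C ∉ (W.baseChange K).kummerSelmerStructure ((2 ^ M : ℕ) : ℤ) (Sum.inr v) →
    M ≤ a + b →
    (2 ^ (a + b - M) : ℕ) •
        localTatePairingZMod ((W.baseChange K).torsionGaloisModule ((2 ^ M : ℕ) : ℤ)) (2 ^ M) (Sum.inr v)
          (inv M (Sum.inr v))
          (galoisCohomology.localization ((W.baseChange K).torsionGaloisModule ((2 ^ M : ℕ) : ℤ)) (Sum.inr v) 1 w)
          (galoisCohomology.localization (((W.baseChange K).torsionGaloisModule ((2 ^ M : ℕ) : ℤ)).tateDual (2 ^ M))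
            (Sum.inr v) 1
            (galoisCohomology.map (weilDualIntertwining (W.baseChange K) (2 ^ M) (e M) (hμ M) (hadd₁ M) (hadd₂ M)
              (hgal M)) 1 C)) ≠ 0)
  (hQ2 : KolyvaginRelationAtTwo)
  (hT2 : ∀ (n : ℕ) (d : KolyvaginHeegnerData Dt β ι n) (M : ℕ),
    KolyvaginDescent.KolSupp (Zhang2014.IsKolyvaginPrime (W.conductorNorm ℤ) W K 2) n →
    1 ≤ M → (M : ℕ∞) ≤ Zhang2014.levelIndex W 2 n →
    ∀ v : HeightOneSpectrum (𝓞 K), ((n : ℕ) : 𝓞 K) ∉ v.asIdeal →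
      ((2 ^ 0 : ℕ) : ℤ) • d.kolyvaginClass Nat.prime_two M ∈
        selmerLocalKer (W.baseChange K) (v.adicCompletion K) ((2 ^ M : ℕ) : ℤ))

include halt hnondeg hCM hΔ hsur hK hodd hne3 hns hHN hτ1 hperf hvan h𝒯sd hP4 hP7a hQ2 hT2 in
/-- **KOLYVAGIN'S FIRST SELMER ANNIHILATION AT `2`, core form** (Gross 1991 §10, first eigenspace; McCallum Thm. 5.4, first rung — at
`p = 2` on `Δ < 0`).  For a conductor-`1` datum `d₁` whose class `c_M(1) = δ_M y_K` has exact order `2^g` (`g ≥ 1`), (NPh) at level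
`2^(M+k)` (`k ≥ 1`, robust `2N`-form), and a Selmer class `z ∈ H¹_𝓕(K, E[2^M])` (Kummer at every place) which is a `τ`-eigenclass of sign
`w = W.rootNumber` — the sign of the once-ramified Kolyvagin classes `c_M(ℓ)`, opposite to that of `c_M(1)` —: **`2^(M+1−g) • z = 0`**.
Proof: if not, `z` has exact order `2^u` with `u + g ≥ M + 2`; the deep pair Čebotarev gives a Kolyvagin prime `ℓ` of index `≥ M + k` with
`Frob_ℓ = Frob_∞` on `K(E[2^(M+k)])` where `loc_λ c_M(1)`, `loc_λ z` have full orders `2^g`, `2^u`; a datum at `ℓ` compatible with `d₁` gives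
`c_M(ℓ) ∈ H¹_{𝓕(ℓ)}` of sign `w` whose Kummer threshold at `λ` is `g` (Q2); the one-term reciprocity `⟨z, c_M(ℓ)⟩_λ = 0` contradicts P7a⁼.
[cite: GrossLMS1991, §8 Prop. 8.2, §10] [cite: McCallumLMS1991, §4 Prop. 4.4, §5 Lemma 5.3, Thm. 5.4] [cite: Kolyvagin1991MathAnn, §2 Thm. 2.2] -/
theorem selmerLayerOne_core {M k g : ℕ} (d₁ : KolyvaginHeegnerData Dt β ι 1)
    (hM : 1 ≤ M) (hk : 1 ≤ k) (hg : 1 ≤ g) (hord : addOrderOf (d₁.kolyvaginClass Nat.prime_two M) = 2 ^ g)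
    (hNPh : ∀ z : galH1Torsion (W.baseChange K) ((2 ^ (M + k) : ℕ) : ℤ),
      (∀ ρ ∈ torsionFixing (W.baseChange K) ((2 ^ (M + k) : ℕ) : ℤ),
        h1Eval (W.baseChange K) ((2 ^ (M + k) : ℕ) : ℤ) z ρ = 0) →
      (∀ w : HeightOneSpectrum (𝓞 K), ((2 * W.conductorNorm ℤ : ℕ) : 𝓞 K) ∈ w.asIdeal →
        z ∈ selmerLocalKer (W.baseChange K) (w.adicCompletion K) ((2 ^ (M + k) : ℕ) : ℤ)) → z = 0)
    (z : galoisCohomology ((W.baseChange K).torsionGaloisModule ((2 ^ M : ℕ) : ℤ)) 1)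
    (hz : z ∈ (selmerF W ((2 ^ M : ℕ) : ℤ) (𝒯 M) (placesDividing K 1)).selmerGroup)
    (hzτ : conjAct W τ ((2 ^ M : ℕ) : ℤ) z = W.rootNumber • z) :
    ((2 ^ (M + 1 - g) : ℕ) : ℤ) • z = 0 := by
  classical
  haveI : Fact (Nat.Prime 2) := ⟨Nat.prime_two⟩
  have hne4 : NumberField.discr K ≠ -4 := fun h ↦ by
    rw [h] at hodd; have := Int.odd_iff.mp hodd; omega
  have hD : NumberField.discr K < -4 := IsImaginaryQuadratic.discr_lt_neg_four_of_odd hK hodd hne3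
  have hρ2 : W.HasSurjectiveModNGaloisRep 2 := by simpa using hsur 1
  have hsur1 : W.HasSurjectiveModNGaloisRep ((2 : ℤ) ^ 1) := by exact_mod_cast hsur 1
  by_contra H
  -- (0) the exact order `2^u` of `z`, `u + g ≥ M + 2`
  have hMz : ((2 ^ M : ℕ) : ℤ) • z = 0 := zsmul_galH1Torsion_eq_zero (W.baseChange K) _ z
  obtain ⟨u, hru, huM, hu0, hu1⟩ := exists_two_pow_orderExp_swap z hMz H
  have hu_one : 1 ≤ u := by omega
  have hzu : addOrderOf z = 2 ^ u := addOrderOf_eq_two_pow_of_zsmul_swap hu_one hu0 hu1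
  -- (1) the conductor-`1` class `c = c_M(1)`: order `2^g`, `g ≤ M`, sign `−w`
  set c := d₁.kolyvaginClass Nat.prime_two M with hc_def
  have hMc : ((2 ^ M : ℕ) : ℤ) • c = 0 := zsmul_galH1Torsion_eq_zero _ _ _
  have hjc : ((2 ^ (g - 1) : ℕ) : ℤ) • c ≠ 0 := fun h ↦ by
    have hdvd := addOrderOf_dvd_of_nsmul_eq_zero ((natCast_zsmul c (2 ^ (g - 1))).symm.trans h)
    rw [hord, Nat.pow_dvd_pow_iff_le_right (by norm_num)] at hdvd; omega
  have hgM : g ≤ M := by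
    by_contra h
    exact hjc (two_pow_zsmul_eq_zero_of_le_swap (by omega) hMc)
  have h1K : ∀ p ∈ (1 : ℕ).primeFactors, Zhang2014.IsKolyvaginPrime (W.conductorNorm ℤ) W K 2 p ∧
      M ≤ Zhang2014.kolyvaginIndex W 2 p := fun p hp ↦ by simp at hp
  obtain ⟨hε1, hcsign⟩ := KolyvaginClassSign.sign_conjAct_kolyvaginClass_two hK hne3 hne4 hodd hHN hsur1 τ hτ1
    Dt β ι squarefree_one hM h1K d₁
  simp only [Nat.primeFactors_one, Finset.card_empty, pow_zero, mul_one] at hε1 hcsign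
  have hw : W.rootNumber = 1 ∨ W.rootNumber = -1 := by
    rcases hε1 with h | h
    · right; linarith
    · left; linarith
  -- (2) both classes are Selmer at the places over `2N` (for the (NPh) separation)
  have h1Kol : KolyvaginDescent.KolSupp (Zhang2014.IsKolyvaginPrime (W.conductorNorm ℤ) W K 2) 1 :=
    ⟨squarefree_one, fun q hq ↦ by simp at hq⟩
  have h1lev : (M : ℕ∞) ≤ Zhang2014.levelIndex W 2 1 :=
    Zhang2014.natCast_le_levelIndex_iff.mpr fun q hq ↦ by simp at hq
  have hcSel : ∀ w' : HeightOneSpectrum (𝓞 K),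
      c ∈ selmerLocalKer (W.baseChange K) (w'.adicCompletion K) ((2 ^ M : ℕ) : ℤ) := by
    intro w'
    have h1w' : ((1 : ℕ) : 𝓞 K) ∉ w'.asIdeal := by
      rw [Nat.cast_one]; exact fun h ↦ w'.isPrime.ne_top ((Ideal.eq_top_iff_one _).mpr h)
    have h := hT2 1 d₁ M h1Kol hM h1lev w' h1w'
    rwa [pow_zero, Nat.cast_one, one_zsmul] at h
  have hzKum : ∀ w' : HeightOneSpectrum (𝓞 K),
      galoisCohomology.localization ((W.baseChange K).torsionGaloisModule ((2 ^ M : ℕ) : ℤ)) (Sum.inr w') 1 z ∈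
        (W.baseChange K).kummerSelmerStructure ((2 ^ M : ℕ) : ℤ) (Sum.inr w') := by
    intro w'
    have h := (SelmerStructure.mem_selmerGroup_iff _ z).mp hz (Sum.inr w')
    rwa [selmerF_inr, if_neg (by simp)] at h
  have hzSel : ∀ w' : HeightOneSpectrum (𝓞 K),
      z ∈ selmerLocalKer (W.baseChange K) (w'.adicCompletion K) ((2 ^ M : ℕ) : ℤ) := fun w' ↦
    (mem_selmerLocalKer_two_pow_iff W M w' z).mpr (hzKum w')
  -- (3) the deep pair Čebotarev for `(c_M(1), z)`
  have hdvd := natCast_pow_dvd_natCast_pow_add 2 M k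
  have hιinj : Function.Injective (torsionH1OfDvd (W.baseChange K) hdvd) :=
    torsionH1OfDvd_two_pow_injective W K hK hρ2 M k
  have hinf := infinite_kolyvaginPrime_localization_fullOrder_pair_deep W K hCM hΔ hK hns hsur τ hτ1 M k hM c z
    hg hu_one hord hzu hε1 hw hcsign hzτ (fun a' b' hab ↦ by
      have hz0 := hNPh _ hab fun w' hw' ↦
        (RelaxedCount.torsionH1OfDvd_mem_selmerLocalKer_iff_mem (W.baseChange K) hdvd (w'.adicCompletion K) _).mpr
          (add_mem (AddSubgroup.zsmul_mem _ (hcSel w') a') (AddSubgroup.zsmul_mem _ (hzSel w') b'))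
      exact hιinj (by rw [hz0, map_zero]))
  obtain ⟨ℓ, hℓmem⟩ := hinf.nonempty
  obtain ⟨hfrob, hKolℓ, hIℓ, hlocℓ⟩ := hℓmem
  have hℓp : ℓ.Prime := hKolℓ.1
  have hℓ0 : ℓ ≠ 0 := hℓp.ne_zero
  have hℓ1 : ℓ ∉ (1 : ℕ).primeFactors := by simp
  have hℓdvd : ¬ ℓ ∣ 1 := fun h ↦ hℓp.ne_one (Nat.dvd_one.mp h)
  have hMℓ : M ≤ Zhang2014.kolyvaginIndex W 2 ℓ := le_trans (by omega) hIℓ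
  have hM1ℓ : M + 1 ≤ Zhang2014.kolyvaginIndex W 2 ℓ := le_trans (by omega) hIℓ
  obtain ⟨v', hv'⟩ : ∃ v : HeightOneSpectrum (𝓞 K), ((ℓ : ℕ) : 𝓞 K) ∈ v.asIdeal :=
    ⟨⟨Ideal.span {((ℓ : ℕ) : 𝓞 K)}, hKolℓ.2.2.2.2.1, by
        rw [Ne, Ideal.span_singleton_eq_bot]; exact_mod_cast hℓp.ne_zero⟩,
      Ideal.mem_span_singleton_self _⟩
  obtain ⟨hcloc, hzloc⟩ := hlocℓ v' hv'
  -- (4) a datum of conductor `1 · ℓ` compatible with `d₁`, its class `C = c_M(ℓ)`: sign `w`, `C ∈ H¹_{𝓕(ℓ)}`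
  obtain ⟨dℓ, hdℓ⟩ := JET.exists_compatible_data_of_grossCM (N := W.conductorNorm ℤ)
    (phi_heegnerPointOfConductor_mem_range_map_ringClassField_holds (W.conductorNorm ℤ) W K) hK hD hHN 2 Dt β ι
    squarefree_one (fun q hq ↦ by simp at hq) d₁
  obtain ⟨hσ, hS, hS', hemb⟩ := hdℓ ℓ hKolℓ hℓ1
  set d' := dℓ ℓ hKolℓ hℓ1 with hd'_def
  have hN : Squarefree (1 * ℓ) := by rw [one_mul]; exact hℓp.squarefree
  have hN0 : 1 * ℓ ≠ 0 := hN.ne_zero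
  have hNpf : (1 * ℓ).primeFactors = {ℓ} := by rw [one_mul, hℓp.primeFactors]
  have hNK : ∀ q ∈ (1 * ℓ).primeFactors, Zhang2014.IsKolyvaginPrime (W.conductorNorm ℤ) W K 2 q ∧
      M + 1 ≤ Zhang2014.kolyvaginIndex W 2 q := by
    intro q hq
    rw [hNpf, Finset.mem_singleton] at hq
    subst hq
    exact ⟨hKolℓ, hM1ℓ⟩
  have hNK' : ∀ q ∈ (1 * ℓ).primeFactors, Zhang2014.IsKolyvaginPrime (W.conductorNorm ℤ) W K 2 q ∧
      M ≤ Zhang2014.kolyvaginIndex W 2 q :=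
    fun q hq ↦ ⟨(hNK q hq).1, Nat.le_of_succ_le (hNK q hq).2⟩
  have hNKol : KolyvaginDescent.KolSupp (Zhang2014.IsKolyvaginPrime (W.conductorNorm ℤ) W K 2) (1 * ℓ) :=
    ⟨hN, fun q hq ↦ (hNK q hq).1⟩
  set C := d'.kolyvaginClass Nat.prime_two M with hC_def
  obtain ⟨-, hCsign⟩ := KolyvaginClassSign.sign_conjAct_kolyvaginClass_two hK hne3 hne4 hodd hHN hsur1 τ hτ1
    Dt β ι hN hM hNK' d'
  have hCsign' : conjAct W τ ((2 ^ M : ℕ) : ℤ) C = W.rootNumber • C := by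
    rw [hC_def, hCsign, hNpf, Finset.card_singleton, pow_one]; ring_nf
  have hCF : C ∈ (selmerF W ((2 ^ M : ℕ) : ℤ) (𝒯 M) (placesDividing K (1 * ℓ))).selmerGroup := by
    have h := zsmul_kolyvaginClass_mem_selmerF W Dt β ι 𝒯 (hK := hK) (hP4 := hP4) (hT2 := hT2) d' hNKol hM
      (fun q hq ↦ (hNK q hq).2)
    rwa [pow_zero, Nat.cast_one, one_zsmul] at h
  -- (5) ONE-term reciprocity at `v'`
  have hsum := sum_localTatePairing_eq_zero_of_dvd W 2 M (e M) (hμ M) (hadd₁ M) (hadd₂ M) (hgal M) (halt M)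
    (hnondeg M) hK hM (inv M) (fun v ↦ ((hperf M) v).1.injective) (hvan M) (𝒯 M) hN0 (one_dvd _)
    (h𝒯sd M (1 * ℓ)) z C hz hCF
  have hv'D : v' ∈ placesDividing K (1 * ℓ) \ placesDividing K 1 := by
    rw [Finset.mem_sdiff, placesDividing_one, mem_placesDividing_iff_natCast_mem hN0, Nat.cast_mul, Nat.cast_one, one_mul]
    exact ⟨hv', by simp⟩
  have hDv : ∀ w ∈ placesDividing K (1 * ℓ) \ placesDividing K 1, w = v' := by
    intro w hw
    rw [Finset.mem_sdiff] at hw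
    obtain ⟨q, hq, hqw⟩ := (natCast_mem_iff_exists_primeFactor_mem hN0 w).mp
      ((mem_placesDividing_iff_natCast_mem hN0 w).mp hw.1)
    rw [hNpf, Finset.mem_singleton] at hq
    subst hq
    exact Summit.BirchSwinnertonDyer.Rank1Residual.JET.Walk.place_eq_of_natCast_mem_of_isPrime hℓ0
      hKolℓ.2.2.2.2.1 w v' hqw hv'
  rw [Finset.sum_eq_single_of_mem v' hv'D (fun w hw hwv ↦ absurd (hDv w hw) hwv)] at hsum
  -- (6) the inputs of P7a⁼ at `v'`
  have hza' : ((2 ^ (u - 1) : ℕ) : ℤ) •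
      galoisCohomology.localization ((W.baseChange K).torsionGaloisModule ((2 ^ M : ℕ) : ℤ)) (Sum.inr v') 1 z ≠ 0 := by
    intro h0
    have h1 : ((2 ^ (u - 1) : ℕ) : ℤ) • z ∈ (W.baseChange K).torsionLocalKer (v'.adicCompletion K) ((2 ^ M : ℕ) : ℤ) :=
      (mem_torsionLocalKer_two_pow_iff W M v' _).mpr ((map_zsmul _ _ _).trans h0)
    have := (hzloc (u - 1)).mp h1
    omega
  have hcj : ((2 ^ (g - 1) : ℕ) : ℤ) • c ∉ (W.baseChange K).torsionLocalKer (v'.adicCompletion K) ((2 ^ M : ℕ) : ℤ) := by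
    intro h; have := (hcloc (g - 1)).mp h; omega
  have hQℓ := hQ2 W hCM K hK hne3 hne4 hHN hsur Dt β ι M hM 1 ℓ hN hℓp hℓdvd hNK' d₁ d' hσ hS hS' hemb v' hv'
  have hCb : ((2 ^ (g - 1) : ℕ) : ℤ) •
      galoisCohomology.localization ((W.baseChange K).torsionGaloisModule ((2 ^ M : ℕ) : ℤ)) (Sum.inr v') 1 C ∉
      (W.baseChange K).kummerSelmerStructure ((2 ^ M : ℕ) : ℤ) (Sum.inr v') := by
    intro h
    have h1 : ((2 ^ (g - 1) : ℕ) : ℤ) • C ∈ selmerLocalKer (W.baseChange K) (v'.adicCompletion K) ((2 ^ M : ℕ) : ℤ) :=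
      (mem_selmerLocalKer_two_pow_iff W M v' _).mpr (mem_of_eq_of_mem_swap h (map_zsmul _ _ _))
    exact hcj ((hQℓ (g - 1)).2.mp ((hQℓ (g - 1)).1.mp h1))
  -- (7) P7a⁼: the `v'`-term is NOT killed by `2^(u + g − 2 − M)` — but it vanishes: contradiction
  have hA := hP7a M (M + k) ℓ v' z C W.rootNumber (u - 1) (g - 1) hw hKolℓ hMℓ (by omega) hfrob hv' hzτ hCsign'
    (hzKum v') hza' hCb (by omega)
  exact hA (by rw [hsum, smul_zero])

end Frame

/-! ## §2 The core on the HYBRID transverse frame — P8, P4, P7a⁼, T2 discharged (as in `exactSwap_core_hybrid_frob`) -/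

section HybridFrame

variable {K : Type} [Field K] [NumberField K] (W : WeierstrassCurve ℚ) [W.IsElliptic]
  [W.IsGloballyMinimal] [(W.baseChange K).IsElliptic] [NeZero (W.conductorNorm ℤ)]
  [∀ M : ℕ, NeZero (2 ^ M)] [∀ M : ℕ, Finite (geomTorsion (W.baseChange K) ((2 ^ M : ℕ) : ℤ))]
  (τ : K ≃ₐ[ℚ] K)
  (Dt : ModularParametrizationData W (W.conductorNorm ℤ)) (β : ℤ) (ι : K →+* ℂ)
  [∀ j : ℕ, NumberField (ringClassField K ι j)]
  (e : ∀ M : ℕ, geomTorsion (W.baseChange K) ((2 ^ M : ℕ) : ℤ) →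
    geomTorsion (W.baseChange K) ((2 ^ M : ℕ) : ℤ) → AlgebraicClosure K)
  (hμ : ∀ M S T, e M S T ^ (2 ^ M) = 1)
  (hadd₁ : ∀ M S₁ S₂ T, e M (S₁ + S₂) T = e M S₁ T * e M S₂ T)
  (hadd₂ : ∀ M S T₁ T₂, e M S (T₁ + T₂) = e M S T₁ * e M S T₂)
  (hgal : ∀ M (g : absoluteGaloisGroup K) (S T : geomTorsion (W.baseChange K) ((2 ^ M : ℕ) : ℤ)),
    g • e M S T = e M (g • S) (g • T))
  (halt : ∀ M T, e M T T = 1) (hnondeg : ∀ M T, (∀ S, e M S T = 1) → T = 0)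
  (hτe : ∀ (M : ℕ) S T, liftAut τ (e M S T) =
    e M ((isLiftOfAut_liftAut τ).torsionMap W ((2 ^ M : ℕ) : ℤ) S)
      ((isLiftOfAut_liftAut τ).torsionMap W ((2 ^ M : ℕ) : ℤ) T))
  (inv : ∀ M : ℕ, LocalInvariants K (2 ^ M))
  (𝒯 : ∀ M : ℕ, SelmerStructure ((W.baseChange K).torsionGaloisModule ((2 ^ M : ℕ) : ℤ)))
  -- the habitat of LINE 18
  (hCM : ¬ W.HasCM) (hΔ : W.Δ < 0) (hTam : Odd W.tamagawaProduct)
  (hsur : ∀ m : ℕ, W.HasSurjectiveModNGaloisRep (2 ^ m : ℕ)) (hK : IsImaginaryQuadratic K)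
  (hodd : Odd (NumberField.discr K)) (hne3 : NumberField.discr K ≠ -3)
  (hns : ¬ IsSquare ((NumberField.discr K : ℚ) * -|W.Δ|))
  (hHN : SatisfiesHeegnerHypothesis (W.conductorNorm ℤ) K)
  (hτ1 : τ ≠ 1)
  (hperf : ∀ M, (inv M).IsPerfect) (hvan : ∀ M, (inv M).SumLocalTermEqZero)
  (hinvc : ∀ M, (inv M).IsConjCompatible τ)
  -- the hybrid transverse structures
  (hTko : ∀ (M : ℕ) (v : HeightOneSpectrum (𝓞 K)) (q : ℕ),
    Zhang2014.IsKolyvaginPrime (W.conductorNorm ℤ) W K 2 q → M + 1 ≤ Zhang2014.kolyvaginIndex W 2 q →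
    (q : 𝓞 K) ∈ v.asIdeal →
    𝒯 M (Sum.inr v) = ⨅ (w' : HeightOneSpectrum (𝓞 (ringClassField K ι q)))
        (_ : w'.asIdeal.LiesOver v.asIdeal),
        letI := (adicCompletionOfLiesOver K (ringClassField K ι q) v w').toAlgebra
        transverseSubgroup (GaloisRep.toLocal v ((W.baseChange K).torsionGaloisModule ((2 ^ M : ℕ) : ℤ)))
          (w'.adicCompletion (ringClassField K ι q)))
  (hTku : ∀ (M : ℕ) (v : HeightOneSpectrum (𝓞 K)),
    (¬ ∃ q : ℕ, Zhang2014.IsKolyvaginPrime (W.conductorNorm ℤ) W K 2 q ∧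
        M + 1 ≤ Zhang2014.kolyvaginIndex W 2 q ∧ (q : 𝓞 K) ∈ v.asIdeal) →
    𝒯 M (Sum.inr v) = (W.baseChange K).kummerSelmerStructure ((2 ^ M : ℕ) : ℤ) (Sum.inr v))
  (hQ2 : KolyvaginRelationAtTwo)

include hμ hadd₁ hadd₂ hgal halt hnondeg hτe hCM hΔ hTam hsur hK hodd hne3 hns hHN hτ1 hperf hvan hinvc hTko hTku hQ2 in
/-- **Layer 1 on the hybrid transverse frame** — `selmerLayerOne_core` with P8 (`dualTransported_eq_of_hybrid`), P4
(`JET.localization_kolyvaginClass_mem_globalTransverse_two`, (V44) at margin one), P7a⁼ (gk2-p3 g23's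
`swapPairing_pow_smul_ne_zero_at_two_exact`) and T2 with `t = 0` (odd Tamagawa) DISCHARGED; displayed: Q2 by name, (NPh_{M+k}).
[cite: McCallumLMS1991, §4 Lemma 4.3, Prop. 4.4, §5 Lemma 5.3] [cite: Howard2004HeegnerKolyvagin, Lemma 2.7.3] [cite: GrossLMS1991, Prop. 6.2, §10] -/
theorem selmerLayerOne_core_hybrid {M k g : ℕ} (d₁ : KolyvaginHeegnerData Dt β ι 1)
    (hM : 1 ≤ M) (hk : 1 ≤ k) (hg : 1 ≤ g) (hord : addOrderOf (d₁.kolyvaginClass Nat.prime_two M) = 2 ^ g)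
    (hNPh : ∀ z : galH1Torsion (W.baseChange K) ((2 ^ (M + k) : ℕ) : ℤ),
      (∀ ρ ∈ torsionFixing (W.baseChange K) ((2 ^ (M + k) : ℕ) : ℤ),
        h1Eval (W.baseChange K) ((2 ^ (M + k) : ℕ) : ℤ) z ρ = 0) →
      (∀ w : HeightOneSpectrum (𝓞 K), ((2 * W.conductorNorm ℤ : ℕ) : 𝓞 K) ∈ w.asIdeal →
        z ∈ selmerLocalKer (W.baseChange K) (w.adicCompletion K) ((2 ^ (M + k) : ℕ) : ℤ)) → z = 0)
    (z : galoisCohomology ((W.baseChange K).torsionGaloisModule ((2 ^ M : ℕ) : ℤ)) 1)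
    (hz : z ∈ (selmerF W ((2 ^ M : ℕ) : ℤ) (𝒯 M) (placesDividing K 1)).selmerGroup)
    (hzτ : conjAct W τ ((2 ^ M : ℕ) : ℤ) z = W.rootNumber • z) :
    ((2 ^ (M + 1 - g) : ℕ) : ℤ) • z = 0 := by
  classical
  haveI : Fact (Nat.Prime 2) := ⟨Nat.prime_two⟩
  have hne4 : NumberField.discr K ≠ -4 := fun h ↦ by
    rw [h] at hodd; have := Int.odd_iff.mp hodd; omega
  have hD : NumberField.discr K < -4 := IsImaginaryQuadratic.discr_lt_neg_four_of_odd hK hodd hne3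
  have hττ : τ * τ = 1 := mul_self_eq_one_of_isImaginaryQuadratic hK τ
  have hinj : ∀ (M : ℕ) (v : HeightOneSpectrum (𝓞 K)), Injective (inv M (Sum.inr v)) :=
    fun M v ↦ ((hperf M) v).1.injective
  -- P8: self-duality of the hybrid structure at every finite place
  have h𝒯sd : ∀ (M c : ℕ), ∀ v ∈ placesDividing K c,
      (inv M).dualTransported (𝒯 M) (weilDualIntertwining (W.baseChange K) (2 ^ M) (e M) (hμ M) (hadd₁ M)
        (hadd₂ M) (hgal M)) (Sum.inr v) = 𝒯 M (Sum.inr v) := fun M c ↦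
    dualTransported_eq_of_hybrid W M (e M) (hμ M) (hadd₁ M) (hadd₂ M) (hgal M) (halt M) (hnondeg M) (inv M)
      (𝒯 M) hK hD ι (hinj M) (fun v ↦ by
        by_cases h : ∃ q : ℕ, Zhang2014.IsKolyvaginPrime (W.conductorNorm ℤ) W K 2 q ∧
            M + 1 ≤ Zhang2014.kolyvaginIndex W 2 q ∧ (q : 𝓞 K) ∈ v.asIdeal
        · obtain ⟨q, hq, hMq, hqv⟩ := h
          exact Or.inl ⟨q, hq, hMq, hqv, hTko M v q hq hMq hqv⟩
        · exact Or.inr (hTku M v h)) c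
  -- P4: transversality at the primes of the conductor — (V44) at margin one, unconditional at 2
  have hP4 : ∀ (M c : ℕ) (dat : KolyvaginHeegnerData Dt β ι c),
      KolyvaginDescent.KolSupp (Zhang2014.IsKolyvaginPrime (W.conductorNorm ℤ) W K 2) c → 1 ≤ M →
      (∀ q ∈ c.primeFactors, M + 1 ≤ Zhang2014.kolyvaginIndex W 2 q) →
      ∀ w ∈ placesDividing K c,
        galoisCohomology.localization ((W.baseChange K).torsionGaloisModule ((2 ^ M : ℕ) : ℤ)) (Sum.inr w) 1
          (dat.kolyvaginClass Nat.prime_two M) ∈ 𝒯 M (Sum.inr w) := by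
    intro M c dat hc _ hcM w hw
    obtain ⟨𝒯g, h𝒯g, -⟩ := JET.Walk.exists_globalTransverseFamily W ι ((2 ^ M : ℕ) : ℤ)
    have hmem := JET.localization_kolyvaginClass_mem_globalTransverse_two W hK hD Dt β ι M h𝒯g dat hc hcM w hw
    obtain ⟨q, hqc, hqw⟩ := (natCast_mem_iff_exists_primeFactor_mem hc.1.ne_zero w).mp
      ((mem_placesDividing_iff_natCast_mem hc.1.ne_zero w).mp hw)
    rw [hTko M w q (hc.2 q hqc) (hcM q hqc) hqw, ← JET.Walk.globalTransverse_eq_of_natCast_mem h𝒯g w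
      (Nat.prime_of_mem_primeFactors hqc) hqw]
    exact hmem
  -- P7a⁼: gk2-p3 g23's exact same-sign law (cyclic eigenlines on Δ < 0)
  have hP7a := swapPairing_pow_smul_ne_zero_at_two_exact (W := W) (τ := τ) (e := e) (hμ := hμ) (hadd₁ := hadd₁) (hadd₂ := hadd₂)
    (hgal := hgal) (halt := halt) (hnondeg := hnondeg) (inv := inv) hK hΔ hτ1 hττ hτe hinj hinvc
  -- T2 with t = 0: Gross 6.2(1) / McCallum 4.3 at 2 on the odd-Tamagawa habitat
  have hT2 := pow_zero_zsmul_kolyvaginClass_two_mem_selmerLocalKer_of_odd_tamagawaProduct W hsur hTam hK hne3 hne4 hHN Dt β ι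
  exact selmerLayerOne_core (W := W) (τ := τ) (Dt := Dt) (β := β) (ι := ι) (e := e) (hμ := hμ) (hadd₁ := hadd₁)
    (hadd₂ := hadd₂) (hgal := hgal) (halt := halt) (hnondeg := hnondeg) (inv := inv) (𝒯 := 𝒯) (hCM := hCM) (hΔ := hΔ)
    (hsur := hsur) (hK := hK) (hodd := hodd) (hne3 := hne3) (hns := hns) (hHN := hHN) (hτ1 := hτ1) (hperf := hperf)
    (hvan := hvan) (h𝒯sd := h𝒯sd) (hP4 := hP4) (hP7a := hP7a) (hQ2 := hQ2) (hT2 := hT2) d₁ hM hk hg hord hNPh z hz hzτ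

end HybridFrame

end Summit.BirchSwinnertonDyer.BirchSwinnertonDyer.Theorems.GenusExact.PlusDescent

end
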